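import Mathlib
import Summits.NavierStokesRegularity.NavierStokesRegularity.Theorems.LerayQuarterDissipationFiniteDissipationLiouvilleVorticityAmplitudeRegion
import Summits.NavierStokesRegularity.NavierStokesRegularity.Theorems.LerayQuarterDissipationFiniteDissipationLiouvilleHardness
import HarnessLib

/-!
# Crux `FiniteDissipationLiouville` (stmt-NavierStokesRegularity-22144): the catalogued wall
# `TypeIDSSLiouville` (Bradshaw–Tsai OP 5.1) HOLDS, for every factor, on the Type-I DSS fields of
# vorticity amplitude `(−t)‖ω‖ ≤ √3/4` (and on the joint `(C, C_ω)` region) — law-free statements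

Theorems file of route `LerayQuarterDissipation` (lead prover g15; `--supports` the crux; corollaries
of `…VorticityAmplitudeRegion` with the route's hardness bridge `…Hardness`). Navier–Stokes regularity
is NOT proved by anything here; no summit is.

The route's wall `Literature.Analysis.FluidPDE.TypeIDSSLiouville c` («a backward `c`-DSS ancient mild
solution with a Type-I envelope `‖u(t,x)‖ ≤ C₀/(‖x‖ + √(−t))` vanishes», Bradshaw–Tsai 2017 OP 5.1,
Tsai GSM 192 Conj. 8.8–8.9) is OPEN for factors away from `1` and NECESSARY for the crux. Its smooth
(Oseen/KNSS-gauge) members lie in the finite-dissipation stratum: the envelope yields the quarter-rate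
law (`Hardness.exists_dissipationLaw_of_hasTypeIDecay`, lead p1 g2). Hence the stratum's vorticity
thresholds become LAW-FREE statements about Type-I DSS fields:

* `eq_zero_of_typeI_dss_of_vorticity_le` — **a Type-I ancient mild field in the KNSS gauge with a
  Type-I envelope, discretely self-similar on the past with ANY factor `c > 1`, whose vorticity obeys
  `(−t)‖curl V(t,x)‖ ≤ √3/4` for all `t < 0`, `x`, vanishes identically**;
* `eq_zero_of_typeI_dss_of_vorticity_le'` — the same for `IsDiscretelySelfSimilar c V`;
* `eq_zero_of_typeI_envelope_of_joint` — (no self-similarity needed) a Type-I ancient mild field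
  with a Type-I envelope and `λ²C² + (1−λ)(4/√3)C_ω < 1` for some `λ ∈ (0,1]` vanishes identically
  (`eq_zero_of_joint` + the law from the envelope); in particular (`λ → 0`) every enveloped Type-I
  ancient field with `(−t)‖curl V‖ ≤ C_ω < √3/4` vanishes, and (`C ≤ 1`) so does every one with
  `C_ω < √3/2` (`eq_zero_of_typeI_envelope_le_one_of_vorticity_lt`).

So Bradshaw–Tsai OP 5.1 is settled affirmatively on the sub-class «vorticity amplitude `≤ √3/4`»
(every factor), and more generally on the joint region. HONEST FRAMING: a restriction of the catalogued
open problem to an explicit sub-class; the wall for larger vorticity amplitudes stays OPEN; nothing here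
bears on Navier–Stokes regularity or blow-up.

References: Bradshaw–Tsai, Ann. Henri Poincaré 18 (2017) / Comm. PDE 42 (2017) OP 5.1; Chae–Wolf,
arXiv:1610.09464; Koch–Nadirashvili–Seregin–Šverák 2009; Tsai, GSM 192, Conj. 8.8–8.9.
-/

noncomputable section

set_option linter.dupNamespace false

namespace Summit.NavierStokesRegularity.NavierStokesRegularity.Theorems.FiniteDissipationLiouville.VorticityAmplitude

open MeasureTheory Set Filter Topology Metric Function
open Literature.Analysis Literature.Analysis.FluidPDE
open Summit.NavierStokesRegularity.NavierStokesRegularity.Theorems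
open Summit.NavierStokesRegularity.NavierStokesRegularity.Theorems.FiniteDissipationLiouville

variable {C C₀ : ℝ} {V : ℝ → EuclideanSpace ℝ (Fin 3) → EuclideanSpace ℝ (Fin 3)}

/-- **Bradshaw–Tsai OP 5.1 on the sub-class of vorticity amplitude `≤ √3/4`, every factor.** A Type-I
ancient mild field `V` (KNSS gauge, constant `C`) with a Type-I envelope `HasTypeIDecay C₀ V`, which is
discretely self-similar on the past with some factor `c > 1` and whose vorticity satisfies
`(−t)‖curl V(t,x)‖ ≤ √3/4` for all `t < 0`, `x`, vanishes identically on `t < 0` (the envelope gives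
the quarter-rate law; `eq_zero_of_pastDss_of_vorticity_le`). [cite: KochNadirashviliSereginSverak2009, §4 (arXiv:0709.3599 p. 8)] -/
theorem eq_zero_of_typeI_dss_of_vorticity_le (hV : IsTypeIAncientMild C V) (hdec : HasTypeIDecay C₀ V)
    {c : ℝ} (hc : 1 < c) (hdss : ∀ t : ℝ, t < 0 → ∀ x, c • V (c ^ 2 * t) (c • x) = V t x)
    (hω : ∀ t : ℝ, t < 0 → ∀ x, (-t) * ‖curl (V t) x‖ ≤ Real.sqrt 3 / 4) :
    ∀ t < 0, ∀ x, V t x = 0 := by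
  obtain ⟨K', hlaw⟩ := Hardness.exists_dissipationLaw_of_hasTypeIDecay hV hdec
  exact eq_zero_of_pastDss_of_vorticity_le hV hlaw hω hc hdss

/-- The same for a field discretely self-similar at all times (`IsDiscretelySelfSimilar c V`, the
Literature's notion). [cite: KochNadirashviliSereginSverak2009, §4 (arXiv:0709.3599 p. 8)] -/
theorem eq_zero_of_typeI_dss_of_vorticity_le' (hV : IsTypeIAncientMild C V) (hdec : HasTypeIDecay C₀ V)
    {c : ℝ} (hc : 1 < c) (hdss : IsDiscretelySelfSimilar c V)
    (hω : ∀ t : ℝ, t < 0 → ∀ x, (-t) * ‖curl (V t) x‖ ≤ Real.sqrt 3 / 4) :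
    ∀ t < 0, ∀ x, V t x = 0 := by
  refine eq_zero_of_typeI_dss_of_vorticity_le hV hdec hc (fun t _ x => ?_) hω
  have h := congrFun (congrFun hdss t) x
  rwa [nsRescale_apply] at h

/-- **Enveloped Type-I ancient fields on the joint region vanish** (no self-similarity needed): a Type-I
ancient mild field (constant `C`) with a Type-I envelope, vorticity amplitude `(−t)‖curl V‖ ≤ C_ω`, and
`λ²C² + (1−λ)(4/√3)C_ω < 1` for some `0 < λ ≤ 1`, vanishes identically (law from the envelope, then
`eq_zero_of_joint`). [cite: KochNadirashviliSereginSverak2009, §4 (arXiv:0709.3599 p. 8)] -/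
theorem eq_zero_of_typeI_envelope_of_joint (hV : IsTypeIAncientMild C V) (hdec : HasTypeIDecay C₀ V)
    {Cω : ℝ} (hω : ∀ t : ℝ, t < 0 → ∀ x, (-t) * ‖curl (V t) x‖ ≤ Cω)
    {lam : ℝ} (hlam0 : 0 < lam) (hlam1 : lam ≤ 1)
    (hjoint : lam ^ 2 * C ^ 2 + (1 - lam) * (4 * Cω * Real.sqrt 3 / 3) < 1) :
    ∀ t < 0, ∀ x, V t x = 0 := by
  obtain ⟨K', hlaw⟩ := Hardness.exists_dissipationLaw_of_hasTypeIDecay hV hdec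
  exact eq_zero_of_joint hV hlaw hω hlam0 hlam1 hjoint

/-- **Enveloped Type-I ancient fields with vorticity amplitude below `√3/4` vanish** (the `λ → 0` end
of the joint region, through `eq_zero_of_vorticity_lt`). [cite: KochNadirashviliSereginSverak2009, §4 (arXiv:0709.3599 p. 8)] -/
theorem eq_zero_of_typeI_envelope_of_vorticity_lt (hV : IsTypeIAncientMild C V) (hdec : HasTypeIDecay C₀ V)
    {Cω : ℝ} (hCω : Cω < Real.sqrt 3 / 4) (hω : ∀ t : ℝ, t < 0 → ∀ x, (-t) * ‖curl (V t) x‖ ≤ Cω) :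
    ∀ t < 0, ∀ x, V t x = 0 := by
  obtain ⟨K', hlaw⟩ := Hardness.exists_dissipationLaw_of_hasTypeIDecay hV hdec
  exact eq_zero_of_vorticity_lt hV hlaw hCω hω

/-- **The corner `C ≤ 1`**: an enveloped Type-I ancient mild field with Type-I constant `C ≤ 1` and
vorticity amplitude `(−t)‖curl V‖ ≤ C_ω < √3/2` vanishes identically. [cite: KochNadirashviliSereginSverak2009, §4 (arXiv:0709.3599 p. 8)] -/
theorem eq_zero_of_typeI_envelope_le_one_of_vorticity_lt (hV : IsTypeIAncientMild C V) (hC1 : C ≤ 1)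
    (hdec : HasTypeIDecay C₀ V) {Cω : ℝ} (hCω : Cω < Real.sqrt 3 / 2)
    (hω : ∀ t : ℝ, t < 0 → ∀ x, (-t) * ‖curl (V t) x‖ ≤ Cω) :
    ∀ t < 0, ∀ x, V t x = 0 := by
  obtain ⟨K', hlaw⟩ := Hardness.exists_dissipationLaw_of_hasTypeIDecay hV hdec
  exact eq_zero_of_typeI_le_one_of_vorticity_lt hV hC1 hlaw hCω hω

end Summit.NavierStokesRegularity.NavierStokesRegularity.Theorems.FiniteDissipationLiouville.VorticityAmplitude

end
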